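import Literature.Analysis.FluidPDE.LThetaEnergyIdentities
import Literature.Analysis.FluidPDE.BeiraoDaVeigaEnstrophyGronwall
import HarnessLib

/-!
# Pressure bounds for the `L^θ` energy method, `θ ≥ 4` (Lemarié-Rieusset, Prop. 11.7, case `q ≥ 3`)

Analysis/FluidPDE proof file (theorems only: no definition, no named fact, no `sorry`).
Search for candidate a priori estimates; no regularity claim. First bricks of the case `q ≥ 3`
(`θ = 3q - 2 ≥ 7`) of the pressure regularity criterion
`Literature.Analysis.FluidPDE.pressureGradientCriterion` (Lemarié-Rieusset 2016, §11.5 Prop. 11.7,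
PDF pp. 365–366), complementing the `L⁴` chain (`LFourPressureSliceEstimate`,
`PressureGradientCriterionLFour`, case `1 < q < 3`). For one slice `v = u(t)` with pressure `ϖ`
and `θ ≥ 4`, the pressure term of the `L^θ` balance
(`Literature.Analysis.FluidPDE.integral_norm_rpow_inner_eq_of_momentum`:
`θ(θ-2)∫ϖ‖v‖^{θ-4}⟪v,(v·∇)v⟫ = -θ∫⟪∇ϖ, ‖v‖^{θ-2}v⟫`) obeys the two bounds of LR (11.55)–(11.56):

* `|∫⟪∇ϖ, ‖v‖^{θ-2}v⟫| ≤ ‖∇ϖ‖_{L^q} (∫‖v‖^{(θ-1)q'})^{1/q'}`, `q' = q/(q-1)` (Hölder; LR (11.55)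
  `|J| ≤ θ∫|∇ϖ||u|^{θ-1} ≤ θ‖∇ϖ‖_q‖u‖_{(θ-1)q'}^{θ-1}`) —
  `abs_integral_inner_gradient_norm_rpow_smul_le`;
* `|∫ϖ‖v‖^{θ-4}⟪v,(v·∇)v⟫| ≤ (∫ϖ²‖v‖^{θ-2})^{1/2}(∫‖v‖^{θ-4}Σᵢ⟪v,∂ᵢv⟫²)^{1/2}` (Cauchy–Schwarz;
  LR (11.56), `∫‖v‖^{θ-4}Σᵢ⟪v,∂ᵢv⟫² = (4/θ²)‖∇|v|^{θ/2}‖₂²` is the second dissipation term) —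
  `abs_integral_mul_norm_rpow_inner_convect_le`;
* `∫ϖ²‖v‖^{θ-2} ≤ C_S² ∫‖v‖^{θ+2}` given the Calderón–Zygmund bound
  `‖ϖ‖_{(θ+2)/2} ≤ C_S‖v‖²_{θ+2}` (Hölder `((θ+2)/4, (θ+2)/(θ-2))`; LR: "since the Riesz transforms
  are bounded on `L^{(θ+2)/2}`") — `integral_sq_mul_norm_rpow_le_of_eLpNorm_le`.

Also: the Sobolev step `∫‖v‖^{3θ} ≤ (K²(θ²/4)∫‖v‖^{θ-4}Σᵢ⟪v,∂ᵢv⟫²)³`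
(`‖|v|^{θ/2}‖_{L⁶} ≤ K‖∇|v|^{θ/2}‖_{L²}`) — `lintegral_norm_rpow_three_mul_le`; and the real-algebra
form of LR's geometric mean `|J| = |J|^{1/2}|J|^{1/2}` combined with the interpolation
`‖v‖_{θ+2}^{θ+2} ≤ ‖v‖_θ^{θ-1}‖v‖_{3θ}^{3}` — `gm_interpolation_bound`
(`X ≤ θ√((θ-2)C N) c^{9/(4(θ+2))} E^{Θ} D^{1-Θ}`, `Θ = 3(θ-1)/(4(θ+2))`; the Young absorption with
the dissipation `D` then produces the weight `N^{1/(2Θ)} = ‖∇ϖ‖_q^{p}`, `p = 2(θ+2)/(3(θ-1))`,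
i.e. `2/p + 3/q = 3` with `q = (θ+2)/3` — left, with the slice inequality itself, to the next file).

## References

* [LemarieRieusset2016] P. G. Lemarié-Rieusset, *The Navier–Stokes problem in the 21st century*,
  CRC Press 2016 — §11.5, Prop. 11.7 proof, (11.55)–(11.56) (PDF pp. 365–366).
-/

noncomputable section

open MeasureTheory Set Function Filter Topology InnerProductSpace
open scoped ENNReal NNReal ContDiff RealInnerProductSpace

namespace Literature.Analysis.FluidPDE

section Helpers

/-- **Pointwise Cauchy–Schwarz for the self-transport density**:
`|⟪v, (v·∇)v⟫| ≤ ‖v‖ (Σᵢ ⟪v, ∂ᵢv⟫²)^{1/2}`. [folklore] -/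
private theorem abs_inner_convect_self_le'
    {v : EuclideanSpace ℝ (Fin 3) → EuclideanSpace ℝ (Fin 3)} (x : EuclideanSpace ℝ (Fin 3)) :
    |⟪v x, FluidPDE.convect v v x⟫| ≤
      ‖v x‖ * Real.sqrt (∑ i, ⟪v x, fderiv ℝ v x (EuclideanSpace.basisFun (Fin 3) ℝ i)⟫ ^ 2) := by
  set e := EuclideanSpace.basisFun (Fin 3) ℝ with he
  have hrepr : ∑ i, ⟪e i, v x⟫ • e i = v x := e.sum_repr' (v x)
  have hDv : FluidPDE.convect v v x = ∑ i, ⟪e i, v x⟫ • fderiv ℝ v x (e i) := by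
    rw [FluidPDE.convect]
    calc fderiv ℝ v x (v x) = fderiv ℝ v x (∑ i, ⟪e i, v x⟫ • e i) := by rw [hrepr]
      _ = ∑ i, ⟪e i, v x⟫ • fderiv ℝ v x (e i) := by
          rw [map_sum]
          exact Finset.sum_congr rfl fun i _ => by rw [map_smul]
  have hsum : ⟪v x, FluidPDE.convect v v x⟫ = ∑ i, ⟪e i, v x⟫ * ⟪v x, fderiv ℝ v x (e i)⟫ := by
    rw [hDv, inner_sum]
    exact Finset.sum_congr rfl fun i _ => by rw [inner_smul_right]
  rw [hsum]
  have hnorm : Real.sqrt (∑ i, |⟪e i, v x⟫| ^ 2) = ‖v x‖ := by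
    simp_rw [sq_abs]
    rw [e.sum_sq_inner_right, Real.sqrt_sq (norm_nonneg _)]
  calc |∑ i, ⟪e i, v x⟫ * ⟪v x, fderiv ℝ v x (e i)⟫|
      ≤ ∑ i, |⟪e i, v x⟫ * ⟪v x, fderiv ℝ v x (e i)⟫| := Finset.abs_sum_le_sum_abs _ _
    _ = ∑ i, |⟪e i, v x⟫| * |⟪v x, fderiv ℝ v x (e i)⟫| :=
        Finset.sum_congr rfl fun i _ => abs_mul _ _
    _ ≤ Real.sqrt (∑ i, |⟪e i, v x⟫| ^ 2) * Real.sqrt (∑ i, |⟪v x, fderiv ℝ v x (e i)⟫| ^ 2) :=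
        Real.sum_mul_le_sqrt_mul_sqrt _ _ _
    _ = ‖v x‖ * Real.sqrt (∑ i, ⟪v x, fderiv ℝ v x (e i)⟫ ^ 2) := by
        rw [hnorm]
        simp_rw [sq_abs]

/-- **Powers of a bounded `L²` slice are in every `L^P`**: for a continuous field `v` with
`‖v‖ ≤ B`, `∫‖v‖² < ∞`, an exponent `e > 0` and `P < ∞` with `2 ≤ e·P`:
`‖v‖^e ∈ L^P` (`∫(‖v‖^e)^P = ∫‖v‖^{eP} ≤ B^{eP-2}∫‖v‖²`). [folklore] -/
private theorem memLp_norm_rpow_of_bound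
    {v : EuclideanSpace ℝ (Fin 3) → EuclideanSpace ℝ (Fin 3)} (hv : Continuous v) {B : ℝ}
    (hB : ∀ x, ‖v x‖ ≤ B) (hv2 : ∫⁻ x, ‖v x‖ₑ ^ 2 < ⊤) {e : ℝ} (he : 0 < e) {P : ℝ≥0∞}
    (hP0 : P ≠ 0) (hPtop : P ≠ ⊤) (h2 : 2 ≤ e * P.toReal) :
    MemLp (fun x => ‖v x‖ ^ e) P volume := by
  have hB0 : 0 ≤ B := (norm_nonneg _).trans (hB 0)
  refine ⟨(hv.norm.rpow_const fun _ => Or.inr he.le).aestronglyMeasurable, ?_⟩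
  rw [eLpNorm_lt_top_iff_lintegral_rpow_enorm_lt_top hP0 hPtop]
  set E : ℝ := e * P.toReal with hE
  have hpt : ∀ x, ‖‖v x‖ ^ e‖ₑ ^ P.toReal ≤ ENNReal.ofReal B ^ (E - 2) * ‖v x‖ₑ ^ 2 := by
    intro x
    have h1 : ‖‖v x‖ ^ e‖ₑ ^ P.toReal = ‖v x‖ₑ ^ E := by
      rw [Real.enorm_eq_ofReal (Real.rpow_nonneg (norm_nonneg _) _),
        ← ENNReal.ofReal_rpow_of_nonneg (norm_nonneg _) he.le, ofReal_norm, ← ENNReal.rpow_mul, hE]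
    have hsplit : ‖v x‖ₑ ^ E = ‖v x‖ₑ ^ (E - 2) * ‖v x‖ₑ ^ (2 : ℝ) := by
      rw [← ENNReal.rpow_add_of_nonneg _ _ (by linarith) (by norm_num)]
      congr 1; ring
    rw [h1, hsplit, ENNReal.rpow_two]
    refine mul_le_mul_left (ENNReal.rpow_le_rpow ?_ (by linarith)) _
    rw [← ofReal_norm]
    exact ENNReal.ofReal_le_ofReal (hB x)
  calc ∫⁻ x, ‖‖v x‖ ^ e‖ₑ ^ P.toReal ≤ ∫⁻ x, ENNReal.ofReal B ^ (E - 2) * ‖v x‖ₑ ^ 2 :=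
        lintegral_mono hpt
    _ = ENNReal.ofReal B ^ (E - 2) * ∫⁻ x, ‖v x‖ₑ ^ 2 :=
        lintegral_const_mul' _ _ (ENNReal.rpow_ne_top_of_nonneg (by linarith) ENNReal.ofReal_ne_top)
    _ < ⊤ := ENNReal.mul_lt_top
        (ENNReal.rpow_lt_top_of_nonneg (by linarith) ENNReal.ofReal_ne_top) hv2

/-- `‖a‖^p = (‖a‖²)^{p/2}`. [folklore] -/
private theorem norm_rpow_eq_sq_rpow' (a : EuclideanSpace ℝ (Fin 3)) (p : ℝ) :
    ‖a‖ ^ p = (‖a‖ ^ 2) ^ (p / 2) := by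
  rw [← Real.rpow_natCast ‖a‖ 2, ← Real.rpow_mul (norm_nonneg _)]
  congr 1
  push_cast
  ring

/-- `D(‖v‖^p)(x) h = p ‖v x‖^{p-2} ⟪v x, Dv(x) h⟫` for `p ≥ 2`. [folklore] -/
private theorem fderiv_norm_rpow_apply'
    {v : EuclideanSpace ℝ (Fin 3) → EuclideanSpace ℝ (Fin 3)}
    {x : EuclideanSpace ℝ (Fin 3)} (hd : DifferentiableAt ℝ v x) {p : ℝ} (hp : 2 ≤ p) :
    DifferentiableAt ℝ (fun y => ‖v y‖ ^ p) x ∧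
      ∀ h, fderiv ℝ (fun y => ‖v y‖ ^ p) x h = p * ‖v x‖ ^ (p - 2) * ⟪v x, fderiv ℝ v x h⟫ := by
  have h1 := hd.hasFDerivAt.norm_sq
  have h2 := h1.rpow_const (p := p / 2) (Or.inr (by linarith))
  have h3 : HasFDerivAt (fun y => ‖v y‖ ^ p) _ x :=
    h2.congr_of_eventuallyEq (Eventually.of_forall fun y => norm_rpow_eq_sq_rpow' (v y) p)
  refine ⟨h3.differentiableAt, fun h => ?_⟩
  rw [h3.fderiv]
  simp [innerSL_apply_apply]
  rw [norm_rpow_eq_sq_rpow' (v x) (p - 2)]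
  have : (p - 2) / 2 = p / 2 - 1 := by ring
  rw [this]
  ring

/-- `y ↦ ‖v y‖^p` is `C¹` for `v ∈ C¹` and `p ≥ 2`. [folklore] -/
private theorem contDiff_norm_rpow' {v : EuclideanSpace ℝ (Fin 3) → EuclideanSpace ℝ (Fin 3)}
    (hv : ContDiff ℝ 1 v) {p : ℝ} (hp : 2 ≤ p) : ContDiff ℝ 1 (fun y => ‖v y‖ ^ p) := by
  have h : ContDiff ℝ 1 (fun y => (‖v y‖ ^ 2) ^ (p / 2)) :=
    (hv.norm_sq ℝ).rpow_const_of_le (by norm_cast; linarith)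
  have hfun : (fun y => ‖v y‖ ^ p) = fun y => (‖v y‖ ^ 2) ^ (p / 2) :=
    funext fun y => norm_rpow_eq_sq_rpow' (v y) p
  rw [hfun]
  exact h

end Helpers

section Bounds

variable {v : EuclideanSpace ℝ (Fin 3) → EuclideanSpace ℝ (Fin 3)} {q : EuclideanSpace ℝ (Fin 3) → ℝ}

/-- **Cauchy–Schwarz for the weighted pressure production** (Lemarié-Rieusset 2016, proof of
Prop. 11.7, (11.56)): for a `C¹` bounded field `v` with `Dv ∈ L²`, a continuous `q ∈ L²` and
`θ ≥ 4`,
`|∫ q ‖v‖^{θ-4}⟪v,(v·∇)v⟫| ≤ (∫ q²‖v‖^{θ-2})^{1/2} (∫ ‖v‖^{θ-4}Σᵢ⟪v,∂ᵢv⟫²)^{1/2}`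
(pointwise `|⟪v,(v·∇)v⟫| ≤ ‖v‖(Σᵢ⟪v,∂ᵢv⟫²)^{1/2}`, `‖v‖^{θ-3} = ‖v‖^{(θ-2)/2}‖v‖^{(θ-4)/2}`).
[cite: LemarieRieusset2016, §11.5 Prop. 11.7 proof, (11.56) (PDF p. 366)] -/
theorem abs_integral_mul_norm_rpow_inner_convect_le (hv : ContDiff ℝ 1 v) {B : ℝ}
    (hB : ∀ x, ‖v x‖ ≤ B)
    (hv1 : ∫⁻ x, ‖iteratedFDeriv ℝ 1 v x‖ₑ ^ 2 < ⊤) (hqc : Continuous q)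
    (hq0 : ∫⁻ x, ‖q x‖ₑ ^ 2 < ⊤) {θ : ℝ} (hθ : 4 ≤ θ) :
    |∫ x, q x * (‖v x‖ ^ (θ - 4) * ⟪v x, FluidPDE.convect v v x⟫)| ≤
      Real.sqrt (∫ x, q x ^ 2 * ‖v x‖ ^ (θ - 2)) *
        Real.sqrt (∫ x, ‖v x‖ ^ (θ - 4) *
          ∑ i, ⟪v x, fderiv ℝ v x (EuclideanSpace.basisFun (Fin 3) ℝ i)⟫ ^ 2) := by
  set e := EuclideanSpace.basisFun (Fin 3) ℝ with he
  have hB0 : 0 ≤ B := (norm_nonneg _).trans (hB 0)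
  have cv : Continuous v := hv.continuous
  have cdv : ∀ i, Continuous fun x => fderiv ℝ v x (e i) := fun i =>
    (hv.continuous_fderiv one_ne_zero).clm_apply continuous_const
  have n_dv : ∀ i x, ‖fderiv ℝ v x (e i)‖ ≤ ‖iteratedFDeriv ℝ 1 v x‖ := fun i x =>
    norm_fderiv_apply_basisFun_le v x i
  set G : EuclideanSpace ℝ (Fin 3) → ℝ := fun x => ∑ i, ⟪v x, fderiv ℝ v x (e i)⟫ ^ 2 with hG
  have hG0 : ∀ x, 0 ≤ G x := fun x => Finset.sum_nonneg fun i _ => sq_nonneg _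
  have cG : Continuous G := continuous_finsetSum _ fun i _ => (cv.inner (cdv i)).pow 2
  have crp : ∀ {a : ℝ}, 0 ≤ a → Continuous fun x => ‖v x‖ ^ a := fun ha =>
    cv.norm.rpow_const fun _ => Or.inr ha
  have hrp_le : ∀ {a : ℝ}, 0 ≤ a → ∀ x, ‖v x‖ ^ a ≤ B ^ a := fun ha x =>
    Real.rpow_le_rpow (norm_nonneg _) (hB x) ha
  -- integrability
  have i_q2 : Integrable (fun x => q x ^ 2) volume := by
    have h := FluidPDE.integrable_sq_norm_of_lintegral_lt_top hqc hq0
    refine h.congr (Eventually.of_forall fun x => ?_)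
    simp only [Real.norm_eq_abs, sq_abs]
  have i_P : Integrable (fun x => q x ^ 2 * ‖v x‖ ^ (θ - 2)) volume := by
    have hdom : Integrable (fun x => B ^ (θ - 2) * q x ^ 2) volume := i_q2.const_mul _
    refine hdom.mono' ((hqc.pow 2).mul (crp (by linarith))).aestronglyMeasurable
      (Eventually.of_forall fun x => ?_)
    rw [Real.norm_of_nonneg (mul_nonneg (sq_nonneg _) (Real.rpow_nonneg (norm_nonneg _) _)),
      mul_comm (B ^ (θ - 2))]
    exact mul_le_mul_of_nonneg_left (hrp_le (by linarith) x) (sq_nonneg _)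
  have i_G : Integrable G volume := by
    have i_d1 : Integrable (fun x => ‖iteratedFDeriv ℝ 1 v x‖ ^ 2) volume :=
      FluidPDE.integrable_sq_norm_of_lintegral_lt_top (hv.continuous_iteratedFDeriv le_rfl) hv1
    have hdom : Integrable (fun x => 3 * (B ^ 2 * ‖iteratedFDeriv ℝ 1 v x‖ ^ 2)) volume :=
      (i_d1.const_mul _).const_mul _
    refine hdom.mono' cG.aestronglyMeasurable (Eventually.of_forall fun x => ?_)
    rw [Real.norm_of_nonneg (hG0 x), hG]
    dsimp only
    have hterm : ∀ i, ⟪v x, fderiv ℝ v x (e i)⟫ ^ 2 ≤ B ^ 2 * ‖iteratedFDeriv ℝ 1 v x‖ ^ 2 := by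
      intro i
      rw [← mul_pow]
      have h := abs_real_inner_le_norm (v x) (fderiv ℝ v x (e i))
      calc ⟪v x, fderiv ℝ v x (e i)⟫ ^ 2 = |⟪v x, fderiv ℝ v x (e i)⟫| ^ 2 := (sq_abs _).symm
        _ ≤ (‖v x‖ * ‖fderiv ℝ v x (e i)‖) ^ 2 := pow_le_pow_left₀ (abs_nonneg _) h 2
        _ ≤ (B * ‖iteratedFDeriv ℝ 1 v x‖) ^ 2 :=
            pow_le_pow_left₀ (by positivity)
              (mul_le_mul (hB x) (n_dv i x) (norm_nonneg _) hB0) 2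
    calc ∑ i, ⟪v x, fderiv ℝ v x (e i)⟫ ^ 2 ≤ ∑ _i : Fin 3, B ^ 2 * ‖iteratedFDeriv ℝ 1 v x‖ ^ 2 :=
          Finset.sum_le_sum fun i _ => hterm i
      _ = 3 * (B ^ 2 * ‖iteratedFDeriv ℝ 1 v x‖ ^ 2) := by simp
  have i_WG : Integrable (fun x => ‖v x‖ ^ (θ - 4) * G x) volume := by
    refine (i_G.const_mul (B ^ (θ - 4))).mono' ((crp (by linarith)).mul cG).aestronglyMeasurable
      (Eventually.of_forall fun x => ?_)
    rw [Real.norm_of_nonneg (mul_nonneg (Real.rpow_nonneg (norm_nonneg _) _) (hG0 x))]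
    exact mul_le_mul_of_nonneg_right (hrp_le (by linarith) x) (hG0 x)
  -- the two `L²` functions
  set f : EuclideanSpace ℝ (Fin 3) → ℝ := fun x => |q x| * ‖v x‖ ^ ((θ - 2) / 2) with hf
  set g : EuclideanSpace ℝ (Fin 3) → ℝ := fun x => ‖v x‖ ^ ((θ - 4) / 2) * Real.sqrt (G x) with hg
  have hf0 : ∀ x, 0 ≤ f x := fun x => mul_nonneg (abs_nonneg _) (Real.rpow_nonneg (norm_nonneg _) _)
  have hg0' : ∀ x, 0 ≤ g x := fun x => mul_nonneg (Real.rpow_nonneg (norm_nonneg _) _) (Real.sqrt_nonneg _)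
  have cf : Continuous f := hqc.abs.mul (crp (by linarith))
  have cg : Continuous g := (crp (by linarith)).mul cG.sqrt
  have hf2 : ∀ x, f x ^ 2 = q x ^ 2 * ‖v x‖ ^ (θ - 2) := fun x => by
    rw [hf]; dsimp only
    rw [mul_pow, sq_abs, ← Real.rpow_natCast (‖v x‖ ^ ((θ - 2) / 2)) 2,
      ← Real.rpow_mul (norm_nonneg _)]
    norm_num
  have hg2 : ∀ x, g x ^ 2 = ‖v x‖ ^ (θ - 4) * G x := fun x => by
    rw [hg]; dsimp only
    rw [mul_pow, Real.sq_sqrt (hG0 x), ← Real.rpow_natCast (‖v x‖ ^ ((θ - 4) / 2)) 2,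
      ← Real.rpow_mul (norm_nonneg _)]
    norm_num
  have mf2 : MemLp f 2 volume := by
    refine (memLp_two_iff_integrable_sq cf.aestronglyMeasurable).2 (i_P.congr ?_)
    exact Eventually.of_forall fun x => (hf2 x).symm
  have mg2 : MemLp g 2 volume := by
    refine (memLp_two_iff_integrable_sq cg.aestronglyMeasurable).2 (i_WG.congr ?_)
    exact Eventually.of_forall fun x => (hg2 x).symm
  have mf : MemLp f (ENNReal.ofReal 2) volume := by
    rw [show ENNReal.ofReal 2 = 2 by norm_num]; exact mf2
  have mg : MemLp g (ENNReal.ofReal 2) volume := by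
    rw [show ENNReal.ofReal 2 = 2 by norm_num]; exact mg2
  have i_fg : Integrable (fun x => f x * g x) volume := mf2.integrable_mul mg2
  -- pointwise bound and Cauchy–Schwarz
  have hpt : ∀ x, |q x * (‖v x‖ ^ (θ - 4) * ⟪v x, FluidPDE.convect v v x⟫)| ≤ f x * g x := by
    intro x
    have hsplit : ‖v x‖ ^ (θ - 4) * ‖v x‖ = ‖v x‖ ^ ((θ - 2) / 2) * ‖v x‖ ^ ((θ - 4) / 2) := by
      rw [← Real.rpow_add_one' (norm_nonneg _) (by linarith), ← Real.rpow_add' (norm_nonneg _)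
        (by linarith)]
      congr 1; ring
    rw [abs_mul, abs_mul, abs_of_nonneg (Real.rpow_nonneg (norm_nonneg _) _), hf, hg]
    dsimp only
    calc |q x| * (‖v x‖ ^ (θ - 4) * |⟪v x, FluidPDE.convect v v x⟫|)
        ≤ |q x| * (‖v x‖ ^ (θ - 4) * (‖v x‖ * Real.sqrt (G x))) :=
          mul_le_mul_of_nonneg_left (mul_le_mul_of_nonneg_left (abs_inner_convect_self_le' x)
            (Real.rpow_nonneg (norm_nonneg _) _)) (abs_nonneg _)
      _ = |q x| * ‖v x‖ ^ ((θ - 2) / 2) * (‖v x‖ ^ ((θ - 4) / 2) * Real.sqrt (G x)) := by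
          rw [← mul_assoc (‖v x‖ ^ (θ - 4)), hsplit]; ring
  have hCS := integral_mul_le_Lp_mul_Lq_of_nonneg Real.HolderConjugate.two_two
    (Eventually.of_forall hf0) (Eventually.of_forall hg0') mf mg
  calc |∫ x, q x * (‖v x‖ ^ (θ - 4) * ⟪v x, FluidPDE.convect v v x⟫)|
      ≤ ∫ x, |q x * (‖v x‖ ^ (θ - 4) * ⟪v x, FluidPDE.convect v v x⟫)| := by
        simpa only [Real.norm_eq_abs] using
          norm_integral_le_integral_norm (fun x => q x * (‖v x‖ ^ (θ - 4) * ⟪v x, FluidPDE.convect v v x⟫))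
    _ ≤ ∫ x, f x * g x :=
        integral_mono_of_nonneg (Eventually.of_forall fun x => abs_nonneg _) i_fg
          (Eventually.of_forall hpt)
    _ ≤ (∫ x, f x ^ (2 : ℝ)) ^ (1 / (2 : ℝ)) * (∫ x, g x ^ (2 : ℝ)) ^ (1 / (2 : ℝ)) := hCS
    _ = Real.sqrt (∫ x, q x ^ 2 * ‖v x‖ ^ (θ - 2)) * Real.sqrt (∫ x, ‖v x‖ ^ (θ - 4) * G x) := by
        rw [Real.sqrt_eq_rpow, Real.sqrt_eq_rpow]
        congr 2
        · exact integral_congr_ae (Eventually.of_forall fun x => by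
            simp only [Real.rpow_two]; exact hf2 x)
        · exact integral_congr_ae (Eventually.of_forall fun x => by
            simp only [Real.rpow_two]; exact hg2 x)

/-- **The weighted pressure square through the Calderón–Zygmund bound** (Lemarié-Rieusset 2016,
proof of Prop. 11.7, case `q ≥ 3`: "since the Riesz transforms are bounded on `L^{(θ+2)/2}`",
`|J| ≤ C_θ‖u‖_{θ+2}^{(θ+2)/2}‖|u|^{θ/2}‖_{Ḣ¹}`). For a continuous bounded field `v ∈ L²`, a
continuous `q` with `‖q‖_{L^{(θ+2)/2}} ≤ C_S ‖v‖²_{L^{θ+2}}` (Stein's bound for the normalised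
pressure, a HYPOTHESIS here) and `θ ≥ 4`:
`∫ q²‖v‖^{θ-2} ≤ C_S² ∫‖v‖^{θ+2}` (Hölder with exponents `(θ+2)/4` and `(θ+2)/(θ-2)`).
[cite: LemarieRieusset2016, §11.5 Prop. 11.7 proof, after (11.56) (PDF p. 366)] -/
theorem integral_sq_mul_norm_rpow_le_of_eLpNorm_le (hv : Continuous v) {B : ℝ}
    (hB : ∀ x, ‖v x‖ ≤ B) (hv0 : ∫⁻ x, ‖v x‖ₑ ^ 2 < ⊤) (hqc : Continuous q)
    (hq0 : ∫⁻ x, ‖q x‖ₑ ^ 2 < ⊤) {θ : ℝ} (hθ : 4 ≤ θ) {CS : ℝ≥0}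
    (hRz : eLpNorm q (ENNReal.ofReal ((θ + 2) / 2)) volume ≤
      CS * eLpNorm v (ENNReal.ofReal (θ + 2)) volume ^ 2) :
    ∫ x, q x ^ 2 * ‖v x‖ ^ (θ - 2) ≤ (CS : ℝ) ^ 2 * ∫ x, ‖v x‖ ^ (θ + 2) := by
  have hB0 : 0 ≤ B := (norm_nonneg _).trans (hB 0)
  have hθ2 : 0 < θ + 2 := by linarith
  have hθm2 : 0 < θ - 2 := by linarith
  -- exponents `a = (θ+2)/4`, `b = (θ+2)/(θ-2)`, conjugate
  set a : ℝ := (θ + 2) / 4 with ha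
  set b : ℝ := (θ + 2) / (θ - 2) with hb
  have ha1 : 1 < a := by rw [ha]; linarith
  have ha0 : 0 < a := by linarith
  have hb0 : 0 < b := by rw [hb]; positivity
  have hab : a.HolderConjugate b := by
    rw [Real.holderConjugate_iff]
    refine ⟨ha1, ?_⟩
    rw [ha, hb]; field_simp; ring
  have crp : ∀ {c : ℝ}, 0 ≤ c → Continuous fun x => ‖v x‖ ^ c := fun hc =>
    hv.norm.rpow_const fun _ => Or.inr hc
  have hrp_le : ∀ {c : ℝ}, 0 ≤ c → ∀ x, ‖v x‖ ^ c ≤ B ^ c := fun hc x =>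
    Real.rpow_le_rpow (norm_nonneg _) (hB x) hc
  -- integrability of the real quantities
  have i_q2 : Integrable (fun x => q x ^ 2) volume := by
    have h := FluidPDE.integrable_sq_norm_of_lintegral_lt_top hqc hq0
    refine h.congr (Eventually.of_forall fun x => ?_)
    simp only [Real.norm_eq_abs, sq_abs]
  have i_P : Integrable (fun x => q x ^ 2 * ‖v x‖ ^ (θ - 2)) volume := by
    have hdom : Integrable (fun x => B ^ (θ - 2) * q x ^ 2) volume := i_q2.const_mul _
    refine hdom.mono' ((hqc.pow 2).mul (crp (by linarith))).aestronglyMeasurable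
      (Eventually.of_forall fun x => ?_)
    rw [Real.norm_of_nonneg (mul_nonneg (sq_nonneg _) (Real.rpow_nonneg (norm_nonneg _) _)),
      mul_comm (B ^ (θ - 2))]
    exact mul_le_mul_of_nonneg_left (hrp_le (by linarith) x) (sq_nonneg _)
  have i_v2 : Integrable (fun x => ‖v x‖ ^ 2) volume :=
    FluidPDE.integrable_sq_norm_of_lintegral_lt_top hv hv0
  have i_E : Integrable (fun x => ‖v x‖ ^ (θ + 2)) volume := by
    have hdom : Integrable (fun x => B ^ θ * ‖v x‖ ^ 2) volume := i_v2.const_mul _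
    refine hdom.mono' (crp (by linarith)).aestronglyMeasurable (Eventually.of_forall fun x => ?_)
    rw [Real.norm_of_nonneg (Real.rpow_nonneg (norm_nonneg _) _)]
    have hsplit : ‖v x‖ ^ (θ + 2) = ‖v x‖ ^ θ * ‖v x‖ ^ 2 := by
      rw [← Real.rpow_natCast (‖v x‖) 2, ← Real.rpow_add' (norm_nonneg _) (by linarith)]
      norm_num
    rw [hsplit]
    exact mul_le_mul_of_nonneg_right (hrp_le (by linarith) x) (sq_nonneg _)
  set E : ℝ := ∫ x, ‖v x‖ ^ (θ + 2) with hE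
  have hE0 : 0 ≤ E := integral_nonneg fun x => Real.rpow_nonneg (norm_nonneg _) _
  -- `ℝ≥0∞` renderings
  have hEe : ENNReal.ofReal E = ∫⁻ x, ‖v x‖ₑ ^ (θ + 2) := by
    rw [hE, ofReal_integral_eq_lintegral_ofReal i_E
      (Eventually.of_forall fun x => Real.rpow_nonneg (norm_nonneg _) _)]
    refine lintegral_congr fun x => ?_
    rw [← ofReal_norm, ENNReal.ofReal_rpow_of_nonneg (norm_nonneg _) hθ2.le]
  have hPe : ENNReal.ofReal (∫ x, q x ^ 2 * ‖v x‖ ^ (θ - 2)) =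
      ∫⁻ x, ‖q x‖ₑ ^ (2 : ℝ) * ‖v x‖ₑ ^ (θ - 2) := by
    rw [ofReal_integral_eq_lintegral_ofReal i_P
      (Eventually.of_forall fun x => mul_nonneg (sq_nonneg _) (Real.rpow_nonneg (norm_nonneg _) _))]
    refine lintegral_congr fun x => ?_
    rw [ENNReal.ofReal_mul (sq_nonneg _)]
    congr 1
    · rw [← sq_abs, ← Real.norm_eq_abs, ENNReal.ofReal_pow (norm_nonneg _), ofReal_norm,
        ENNReal.rpow_two]
    · rw [← ofReal_norm, ENNReal.ofReal_rpow_of_nonneg (norm_nonneg _) hθm2.le]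
  -- the norms in `lintegral` form
  have hθ2E : ENNReal.ofReal (θ + 2) ≠ 0 := (ENNReal.ofReal_pos.2 hθ2).ne'
  have hθ22E : ENNReal.ofReal ((θ + 2) / 2) ≠ 0 := (ENNReal.ofReal_pos.2 (by positivity)).ne'
  have hvn : eLpNorm v (ENNReal.ofReal (θ + 2)) volume ^ 2 =
      (∫⁻ x, ‖v x‖ₑ ^ (θ + 2)) ^ (2 / (θ + 2)) := by
    rw [eLpNorm_eq_lintegral_rpow_enorm_toReal hθ2E ENNReal.ofReal_ne_top,
      ENNReal.toReal_ofReal hθ2.le, ← ENNReal.rpow_natCast, ← ENNReal.rpow_mul]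
    congr 1; push_cast; field_simp
  have hqn : eLpNorm q (ENNReal.ofReal ((θ + 2) / 2)) volume =
      (∫⁻ x, ‖q x‖ₑ ^ ((θ + 2) / 2)) ^ (2 / (θ + 2)) := by
    rw [eLpNorm_eq_lintegral_rpow_enorm_toReal hθ22E ENNReal.ofReal_ne_top,
      ENNReal.toReal_ofReal (by positivity)]
    congr 1; field_simp
  rw [hvn, hqn] at hRz
  -- Hölder `(a, b)`
  have hH : ∫⁻ x, ‖q x‖ₑ ^ (2 : ℝ) * ‖v x‖ₑ ^ (θ - 2) ≤
      (∫⁻ x, ‖q x‖ₑ ^ ((θ + 2) / 2)) ^ (1 / a) * (∫⁻ x, ‖v x‖ₑ ^ (θ + 2)) ^ (1 / b) := by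
    have h := ENNReal.lintegral_mul_le_Lp_mul_Lq volume hab
      (f := fun x => ‖q x‖ₑ ^ (2 : ℝ)) (g := fun x => ‖v x‖ₑ ^ (θ - 2))
      (hqc.aemeasurable.enorm.pow_const _) (hv.aemeasurable.enorm.pow_const _)
    have hf : ∀ x, (‖q x‖ₑ ^ (2 : ℝ)) ^ a = ‖q x‖ₑ ^ ((θ + 2) / 2) := fun x => by
      rw [← ENNReal.rpow_mul]; congr 1; rw [ha]; ring
    have hg : ∀ x, (‖v x‖ₑ ^ (θ - 2)) ^ b = ‖v x‖ₑ ^ (θ + 2) := fun x => by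
      rw [← ENNReal.rpow_mul]; congr 1; rw [hb]; field_simp
    simp only [Pi.mul_apply, hf, hg] at h
    exact h
  -- combine: `(∫‖q‖^{(θ+2)/2})^{1/a} = ((∫…)^{2/(θ+2)})² ≤ (CS (∫‖v‖^{θ+2})^{2/(θ+2)})²`
  have h1a : (∫⁻ x, ‖q x‖ₑ ^ ((θ + 2) / 2)) ^ (1 / a) =
      ((∫⁻ x, ‖q x‖ₑ ^ ((θ + 2) / 2)) ^ (2 / (θ + 2))) ^ (2 : ℝ) := by
    rw [← ENNReal.rpow_mul]; congr 1; rw [ha]; field_simp; ring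
  set X : ℝ≥0∞ := ∫⁻ x, ‖v x‖ₑ ^ (θ + 2) with hX
  have hXeq : ((CS : ℝ≥0∞) * X ^ (2 / (θ + 2))) ^ (2 : ℝ) * X ^ (1 / b) = (CS : ℝ≥0∞) ^ 2 * X := by
    rw [ENNReal.mul_rpow_of_nonneg _ _ (by norm_num), ← ENNReal.rpow_mul, ENNReal.rpow_two,
      mul_assoc, ← ENNReal.rpow_add_of_nonneg _ _ (by positivity) (by positivity)]
    have hexp : 2 / (θ + 2) * 2 + 1 / b = 1 := by rw [hb]; field_simp; ring
    rw [hexp, ENNReal.rpow_one]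
  have hcomb : ENNReal.ofReal (∫ x, q x ^ 2 * ‖v x‖ ^ (θ - 2)) ≤ (CS : ℝ≥0∞) ^ 2 * X := by
    rw [hPe]
    refine hH.trans ?_
    rw [h1a, ← hXeq]
    gcongr
  -- back to reals
  have hfin : (CS : ℝ≥0∞) ^ 2 * X ≠ ⊤ := by
    rw [← hEe]; exact ENNReal.mul_ne_top (ENNReal.pow_ne_top ENNReal.coe_ne_top) ENNReal.ofReal_ne_top
  have := (ENNReal.ofReal_le_iff_le_toReal hfin).1 hcomb
  refine this.trans_eq ?_
  rw [← hEe, ENNReal.toReal_mul, ENNReal.toReal_pow, ENNReal.coe_toReal, ENNReal.toReal_ofReal hE0]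

/-- **The pressure pairing through `‖∇ϖ‖_{L^Q}`** (Lemarié-Rieusset 2016, proof of Prop. 11.7,
(11.55): `|J| ≤ θ∫|∇ϖ||u|^{θ-1} ≤ θ‖∇ϖ‖_q‖u‖_{(θ-1)q/(q-1)}^{θ-1}`). For a continuous bounded field
`v ∈ L²`, a `C¹` scalar `π` with `∇π ∈ L^Q`, `1 < Q < ∞`, and `θ ≥ 4`:
`|∫⟪∇π, ‖v‖^{θ-2}v⟫| ≤ (∫‖∇π‖^Q)^{1/Q} (∫‖v‖^{(θ-1)Q'})^{1/Q'}`, `Q' = Q/(Q-1)` (Hölder).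
[cite: LemarieRieusset2016, §11.5 Prop. 11.7 proof, (11.55) (PDF p. 366)] -/
theorem abs_integral_inner_gradient_norm_rpow_smul_le (hv : Continuous v) {B : ℝ}
    (hB : ∀ x, ‖v x‖ ≤ B) (hv0 : ∫⁻ x, ‖v x‖ₑ ^ 2 < ⊤) {π : EuclideanSpace ℝ (Fin 3) → ℝ}
    (hπ : ContDiff ℝ 1 π) {Q : ℝ} (hQ : 1 < Q)
    (hπQ : eLpNorm (fun x => gradient π x) (ENNReal.ofReal Q) volume < ⊤) {θ : ℝ} (hθ : 4 ≤ θ) :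
    |∫ x, ⟪gradient π x, ‖v x‖ ^ (θ - 2) • v x⟫| ≤
      (∫ x, ‖gradient π x‖ ^ Q) ^ (1 / Q) *
        (∫ x, ‖v x‖ ^ ((θ - 1) * (Q / (Q - 1)))) ^ (1 / (Q / (Q - 1))) := by
  set Q' : ℝ := Q / (Q - 1) with hQ'
  have hQ1 : 0 < Q - 1 := by linarith
  have hQ0 : 0 < Q := by linarith
  have hQ'1 : 1 < Q' := by rw [hQ', lt_div_iff₀ hQ1]; linarith
  have hQ'0 : 0 < Q' := by linarith
  have hQQ' : Q.HolderConjugate Q' := by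
    rw [Real.holderConjugate_iff]
    refine ⟨hQ, ?_⟩
    rw [hQ']; field_simp; ring
  -- continuity of the gradient
  have cg : Continuous fun x => gradient π x := by
    have h := (InnerProductSpace.toDual ℝ (EuclideanSpace ℝ (Fin 3))).symm.continuous.comp
      (hπ.continuous_fderiv one_ne_zero)
    exact h
  -- the two factors
  set f : EuclideanSpace ℝ (Fin 3) → ℝ := fun x => ‖gradient π x‖ with hf
  set g : EuclideanSpace ℝ (Fin 3) → ℝ := fun x => ‖v x‖ ^ (θ - 1) with hg
  have hf0 : ∀ x, 0 ≤ f x := fun x => norm_nonneg _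
  have hg0 : ∀ x, 0 ≤ g x := fun x => Real.rpow_nonneg (norm_nonneg _) _
  have mf : MemLp f (ENNReal.ofReal Q) volume := by
    refine ⟨cg.norm.aestronglyMeasurable, ?_⟩
    rw [hf, eLpNorm_norm]; exact hπQ
  have mg : MemLp g (ENNReal.ofReal Q') volume :=
    memLp_norm_rpow_of_bound hv hB hv0 (by linarith) ((ENNReal.ofReal_pos.2 hQ'0).ne')
      ENNReal.ofReal_ne_top (by rw [ENNReal.toReal_ofReal hQ'0.le]; nlinarith)
  -- integrability of the product (Hölder)
  have hHT : ENNReal.HolderTriple (ENNReal.ofReal Q) (ENNReal.ofReal Q') 1 := by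
    refine ⟨?_⟩
    rw [← ENNReal.ofReal_inv_of_pos hQ0, ← ENNReal.ofReal_inv_of_pos hQ'0,
      ← ENNReal.ofReal_add (inv_nonneg.2 hQ0.le) (inv_nonneg.2 hQ'0.le), inv_one]
    have h : Q⁻¹ + Q'⁻¹ = 1 := hQQ'.inv_add_inv_eq_one
    rw [h, ENNReal.ofReal_one]
  have i_fg : Integrable (fun x => f x * g x) volume := by
    haveI := hHT
    exact mf.integrable_mul mg
  -- pointwise bound and Hölder
  have hpt : ∀ x, |⟪gradient π x, ‖v x‖ ^ (θ - 2) • v x⟫| ≤ f x * g x := by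
    intro x
    refine (abs_real_inner_le_norm _ _).trans ?_
    rw [norm_smul, Real.norm_of_nonneg (Real.rpow_nonneg (norm_nonneg _) _), hf, hg]
    dsimp only
    rw [← Real.rpow_add_one' (norm_nonneg _) (by linarith)]
    ring_nf
    exact le_rfl
  have hH := integral_mul_le_Lp_mul_Lq_of_nonneg hQQ' (Eventually.of_forall hf0)
    (Eventually.of_forall hg0) mf mg
  calc |∫ x, ⟪gradient π x, ‖v x‖ ^ (θ - 2) • v x⟫|
      ≤ ∫ x, |⟪gradient π x, ‖v x‖ ^ (θ - 2) • v x⟫| := by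
        simpa only [Real.norm_eq_abs] using
          norm_integral_le_integral_norm (fun x => ⟪gradient π x, ‖v x‖ ^ (θ - 2) • v x⟫)
    _ ≤ ∫ x, f x * g x :=
        integral_mono_of_nonneg (Eventually.of_forall fun x => abs_nonneg _) i_fg
          (Eventually.of_forall hpt)
    _ ≤ (∫ x, f x ^ Q) ^ (1 / Q) * (∫ x, g x ^ Q') ^ (1 / Q') := hH
    _ = (∫ x, ‖gradient π x‖ ^ Q) ^ (1 / Q) * (∫ x, ‖v x‖ ^ ((θ - 1) * Q')) ^ (1 / Q') := by
        congr 2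
        refine integral_congr_ae (Eventually.of_forall fun x => ?_)
        rw [hg]; dsimp only
        rw [← Real.rpow_mul (norm_nonneg _)]

/-- **Sobolev for `|v|^{θ/2}`** (Lemarié-Rieusset 2016, proof of Prop. 11.7: "a control in terms
of `‖u‖_θ` and `‖|u|^{θ/2}‖_{Ḣ¹}` (hence in terms of `‖u‖_{3θ}`)"): for a `C¹` bounded field `v`
with `v, Dv ∈ L²` and `θ ≥ 4`,
`∫‖v‖^{3θ} ≤ (K² (θ²/4) ∫‖v‖^{θ-4}Σᵢ⟪v,∂ᵢv⟫²)³`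
(`‖|v|^{θ/2}‖_{L⁶} ≤ K‖∇|v|^{θ/2}‖_{L²}` by the Gagliardo–Nirenberg–Sobolev inequality for the
real function `|v|^{θ/2}`, and `|∇|v|^{θ/2}|² ≤ (θ²/4)|v|^{θ-4}Σᵢ⟪v,∂ᵢv⟫²` pointwise), stated in
`ℝ≥0∞`: `∫⁻‖v‖ₑ^{3θ} ≤ (K² · ofReal((θ²/4)∫‖v‖^{θ-4}Σᵢ⟪v,∂ᵢv⟫²))³`.
[cite: LemarieRieusset2016, §11.5 Prop. 11.7 proof (PDF p. 366)] -/
theorem lintegral_norm_rpow_three_mul_le (hv : ContDiff ℝ 1 v) {B : ℝ} (hB : ∀ x, ‖v x‖ ≤ B)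
    (hv0 : ∫⁻ x, ‖v x‖ₑ ^ 2 < ⊤) (hv1 : ∫⁻ x, ‖iteratedFDeriv ℝ 1 v x‖ₑ ^ 2 < ⊤)
    {θ : ℝ} (hθ : 4 ≤ θ) :
    ∫⁻ x, ‖v x‖ₑ ^ (3 * θ) ≤
      ((SNormLESNormFDerivOfEqConst ℝ (volume : Measure (EuclideanSpace ℝ (Fin 3))) 2 : ℝ≥0∞) ^ 2 *
        ENNReal.ofReal (θ ^ 2 / 4 * ∫ x, ‖v x‖ ^ (θ - 4) *
          ∑ i, ⟪v x, fderiv ℝ v x (EuclideanSpace.basisFun (Fin 3) ℝ i)⟫ ^ 2)) ^ (3 : ℝ) := by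
  set e := EuclideanSpace.basisFun (Fin 3) ℝ with he
  set K : ℝ≥0 := SNormLESNormFDerivOfEqConst ℝ (volume : Measure (EuclideanSpace ℝ (Fin 3))) 2
    with hK
  have hB0 : 0 ≤ B := (norm_nonneg _).trans (hB 0)
  have hθ2 : 2 ≤ θ / 2 := by linarith
  have cv : Continuous v := hv.continuous
  have cdv : ∀ i, Continuous fun x => fderiv ℝ v x (e i) := fun i =>
    (hv.continuous_fderiv one_ne_zero).clm_apply continuous_const
  have n_dv : ∀ i x, ‖fderiv ℝ v x (e i)‖ ≤ ‖iteratedFDeriv ℝ 1 v x‖ := fun i x =>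
    norm_fderiv_apply_basisFun_le v x i
  -- the function `w = ‖v‖^{θ/2}` and the density `G`
  set w : EuclideanSpace ℝ (Fin 3) → ℝ := fun x => ‖v x‖ ^ (θ / 2) with hw
  have hw1 : ContDiff ℝ 1 w := contDiff_norm_rpow' hv hθ2
  set G : EuclideanSpace ℝ (Fin 3) → ℝ := fun x => ∑ i, ⟪v x, fderiv ℝ v x (e i)⟫ ^ 2 with hG
  have hG0 : ∀ x, 0 ≤ G x := fun x => Finset.sum_nonneg fun i _ => sq_nonneg _
  have cG : Continuous G := continuous_finsetSum _ fun i _ => (cv.inner (cdv i)).pow 2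
  have crp : ∀ {c : ℝ}, 0 ≤ c → Continuous fun x => ‖v x‖ ^ c := fun hc =>
    cv.norm.rpow_const fun _ => Or.inr hc
  have hrp_le : ∀ {c : ℝ}, 0 ≤ c → ∀ x, ‖v x‖ ^ c ≤ B ^ c := fun hc x =>
    Real.rpow_le_rpow (norm_nonneg _) (hB x) hc
  -- integrability of `‖v‖^{θ-4} G`
  have i_G : Integrable G volume := by
    have i_d1 : Integrable (fun x => ‖iteratedFDeriv ℝ 1 v x‖ ^ 2) volume :=
      FluidPDE.integrable_sq_norm_of_lintegral_lt_top (hv.continuous_iteratedFDeriv le_rfl) hv1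
    have hdom : Integrable (fun x => 3 * (B ^ 2 * ‖iteratedFDeriv ℝ 1 v x‖ ^ 2)) volume :=
      (i_d1.const_mul _).const_mul _
    refine hdom.mono' cG.aestronglyMeasurable (Eventually.of_forall fun x => ?_)
    rw [Real.norm_of_nonneg (hG0 x), hG]
    dsimp only
    have hterm : ∀ i, ⟪v x, fderiv ℝ v x (e i)⟫ ^ 2 ≤ B ^ 2 * ‖iteratedFDeriv ℝ 1 v x‖ ^ 2 := by
      intro i
      rw [← mul_pow]
      have h := abs_real_inner_le_norm (v x) (fderiv ℝ v x (e i))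
      calc ⟪v x, fderiv ℝ v x (e i)⟫ ^ 2 = |⟪v x, fderiv ℝ v x (e i)⟫| ^ 2 := (sq_abs _).symm
        _ ≤ (‖v x‖ * ‖fderiv ℝ v x (e i)‖) ^ 2 := pow_le_pow_left₀ (abs_nonneg _) h 2
        _ ≤ (B * ‖iteratedFDeriv ℝ 1 v x‖) ^ 2 :=
            pow_le_pow_left₀ (by positivity)
              (mul_le_mul (hB x) (n_dv i x) (norm_nonneg _) hB0) 2
    calc ∑ i, ⟪v x, fderiv ℝ v x (e i)⟫ ^ 2 ≤ ∑ _i : Fin 3, B ^ 2 * ‖iteratedFDeriv ℝ 1 v x‖ ^ 2 :=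
          Finset.sum_le_sum fun i _ => hterm i
      _ = 3 * (B ^ 2 * ‖iteratedFDeriv ℝ 1 v x‖ ^ 2) := by simp
  have i_WG : Integrable (fun x => ‖v x‖ ^ (θ - 4) * G x) volume := by
    refine (i_G.const_mul (B ^ (θ - 4))).mono' ((crp (by linarith)).mul cG).aestronglyMeasurable
      (Eventually.of_forall fun x => ?_)
    rw [Real.norm_of_nonneg (mul_nonneg (Real.rpow_nonneg (norm_nonneg _) _) (hG0 x))]
    exact mul_le_mul_of_nonneg_right (hrp_le (by linarith) x) (hG0 x)
  set R : ℝ := θ ^ 2 / 4 * ∫ x, ‖v x‖ ^ (θ - 4) * G x with hR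
  have hR0 : 0 ≤ R := mul_nonneg (by positivity)
    (integral_nonneg fun x => mul_nonneg (Real.rpow_nonneg (norm_nonneg _) _) (hG0 x))
  -- `w ∈ L²`: `w² = ‖v‖^θ ≤ B^{θ-2}‖v‖²`
  have l2w : eLpNorm w 2 volume < ⊤ := by
    have hm : MemLp (fun x => ‖v x‖ ^ (θ / 2)) 2 volume :=
      memLp_norm_rpow_of_bound cv hB hv0 (by linarith) two_ne_zero (by simp)
        (by rw [ENNReal.toReal_ofNat]; linarith)
    exact hm.eLpNorm_lt_top
  -- `‖Dw‖² ≤ (θ²/4) ‖v‖^{θ-4} G` pointwise, hence `‖Dw‖²_{L²} ≤ R`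
  have hDw_pt : ∀ x, ‖fderiv ℝ w x‖ ^ 2 ≤ θ ^ 2 / 4 * (‖v x‖ ^ (θ - 4) * G x) := by
    intro x
    have hd : DifferentiableAt ℝ v x := hv.differentiable one_ne_zero x
    obtain ⟨-, happ⟩ := fderiv_norm_rpow_apply' hd hθ2
    refine (FluidPDE.sq_opNorm_le_sum_sq_norm_apply e (fderiv ℝ w x)).trans (le_of_eq ?_)
    rw [hG, Finset.mul_sum, Finset.mul_sum]
    refine Finset.sum_congr rfl fun i _ => ?_
    rw [hw, happ (e i), Real.norm_eq_abs, sq_abs]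
    have hsq : (‖v x‖ ^ (θ / 2 - 2)) ^ 2 = ‖v x‖ ^ (θ - 4) := by
      rw [← Real.rpow_natCast (‖v x‖ ^ (θ / 2 - 2)) 2, ← Real.rpow_mul (norm_nonneg _)]
      congr 1; push_cast; ring
    calc (θ / 2 * ‖v x‖ ^ (θ / 2 - 2) * ⟪v x, fderiv ℝ v x (e i)⟫) ^ 2
        = θ ^ 2 / 4 * (‖v x‖ ^ (θ / 2 - 2)) ^ 2 * ⟪v x, fderiv ℝ v x (e i)⟫ ^ 2 := by ring
      _ = θ ^ 2 / 4 * (‖v x‖ ^ (θ - 4) * ⟪v x, fderiv ℝ v x (e i)⟫ ^ 2) := by rw [hsq]; ring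
  have cDw : Continuous fun x => fderiv ℝ w x := hw1.continuous_fderiv one_ne_zero
  have hDw : eLpNorm (fderiv ℝ w) 2 volume ^ 2 ≤ ENNReal.ofReal R := by
    rw [← lintegral_enorm_sq_eq_eLpNorm_two_sq, hR, ← integral_const_mul,
      ofReal_integral_eq_lintegral_ofReal (i_WG.const_mul _)
        (Eventually.of_forall fun x => mul_nonneg (by positivity)
          (mul_nonneg (Real.rpow_nonneg (norm_nonneg _) _) (hG0 x)))]
    refine lintegral_mono fun x => ?_
    rw [← ofReal_norm, ← ENNReal.ofReal_pow (norm_nonneg _)]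
    exact ENNReal.ofReal_le_ofReal (hDw_pt x)
  -- Sobolev
  have hS : eLpNorm w 6 volume ≤ K * eLpNorm (fderiv ℝ w) 2 volume :=
    FluidPDE.eLpNorm_six_le_eLpNorm_fderiv_two volume finrank_euclideanSpace_fin hw1 l2w
  have h6 : ∫⁻ x, ‖v x‖ₑ ^ (3 * θ) = eLpNorm w 6 volume ^ (6 : ℝ) := by
    rw [eLpNorm_eq_lintegral_rpow_enorm_toReal (by norm_num) (by norm_num), ENNReal.toReal_ofNat,
      ← ENNReal.rpow_mul]
    have e16 : 1 / (6 : ℝ) * 6 = 1 := by norm_num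
    rw [e16, ENNReal.rpow_one]
    refine lintegral_congr fun x => ?_
    rw [hw]
    dsimp only
    rw [Real.enorm_eq_ofReal (Real.rpow_nonneg (norm_nonneg _) _),
      ← ENNReal.ofReal_rpow_of_nonneg (norm_nonneg _) (by linarith), ofReal_norm,
      ← ENNReal.rpow_mul]
    congr 1; ring
  rw [h6]
  calc eLpNorm w 6 volume ^ (6 : ℝ) ≤ (K * eLpNorm (fderiv ℝ w) 2 volume) ^ (6 : ℝ) := by gcongr
    _ = ((K : ℝ≥0∞) ^ 2 * eLpNorm (fderiv ℝ w) 2 volume ^ 2) ^ (3 : ℝ) := by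
        rw [← mul_pow, ← ENNReal.rpow_natCast, ← ENNReal.rpow_mul]; norm_num
    _ ≤ ((K : ℝ≥0∞) ^ 2 * ENNReal.ofReal R) ^ (3 : ℝ) := by gcongr

end Bounds


/-! ### The geometric-mean step of LR p. 366 (real algebra) -/

section Algebra

/-- **The geometric mean of the two pressure bounds, interpolated** (Lemarié-Rieusset 2016,
p. 366: "writing `|J| = |J|^{1/2}|J|^{1/2}`"): if `X ≤ θ N M^{(θ-1)/(θ+2)}`,
`X ≤ θ(θ-2) C M^{1/2} D^{1/2}` and `M ≤ E^{(θ-1)/θ} (c D)^{3/θ}` (all quantities `≥ 0`,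
`θ ≥ 4`), then `X ≤ θ √((θ-2) C N) c^{9/(4(θ+2))} E^{Θ} D^{1-Θ}` with `Θ = 3(θ-1)/(4(θ+2))`.
[cite: LemarieRieusset2016, §11.5 Prop. 11.7 proof (PDF p. 366)] -/
theorem gm_interpolation_bound {X N M E D C c θ : ℝ} (hX : 0 ≤ X) (hN : 0 ≤ N) (hM : 0 ≤ M)
    (hE : 0 ≤ E) (hD : 0 ≤ D) (hC : 0 ≤ C) (hc : 0 ≤ c) (hθ : 4 ≤ θ)
    (b1 : X ≤ θ * N * M ^ ((θ - 1) / (θ + 2)))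
    (b2 : X ≤ θ * (θ - 2) * C * M ^ (1 / 2 : ℝ) * D ^ (1 / 2 : ℝ))
    (hint : M ≤ E ^ ((θ - 1) / θ) * (c * D) ^ (3 / θ)) :
    X ≤ θ * Real.sqrt ((θ - 2) * C * N) * c ^ (9 / (4 * (θ + 2))) *
      E ^ (3 * (θ - 1) / (4 * (θ + 2))) * D ^ (1 - 3 * (θ - 1) / (4 * (θ + 2))) := by
  have hθ0 : 0 < θ := by linarith
  have hθ2 : 0 ≤ θ - 2 := by linarith
  have hθp2 : 0 < θ + 2 := by linarith
  -- `X² ≤ b1 · b2`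
  have he_pos : 0 < (θ - 1) / (θ + 2) + 1 / 2 :=
    add_pos_of_nonneg_of_pos (div_nonneg (by linarith) hθp2.le) (by norm_num)
  set e : ℝ := (θ - 1) / (θ + 2) + 1 / 2 with he
  have he0 : 0 ≤ e := he_pos.le
  have hsq : X ^ 2 ≤ θ ^ 2 * ((θ - 2) * C * N) * M ^ e * D ^ (1 / 2 : ℝ) := by
    have h := mul_le_mul b1 b2 hX (by positivity)
    rw [← sq] at h
    refine h.trans (le_of_eq ?_)
    rw [he, Real.rpow_add' hM he_pos.ne']
    ring
  -- `M^e ≤ E^{(θ-1)e/θ} c^{3e/θ} D^{3e/θ}`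
  have hMe : M ^ e ≤ E ^ ((θ - 1) / θ * e) * (c ^ (3 / θ * e) * D ^ (3 / θ * e)) := by
    calc M ^ e ≤ (E ^ ((θ - 1) / θ) * (c * D) ^ (3 / θ)) ^ e := Real.rpow_le_rpow hM hint he0
      _ = E ^ ((θ - 1) / θ * e) * (c ^ (3 / θ * e) * D ^ (3 / θ * e)) := by
          rw [Real.mul_rpow (Real.rpow_nonneg hE _) (Real.rpow_nonneg (mul_nonneg hc hD) _),
            ← Real.rpow_mul hE, Real.mul_rpow hc hD, Real.mul_rpow (Real.rpow_nonneg hc _)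
            (Real.rpow_nonneg hD _), ← Real.rpow_mul hc, ← Real.rpow_mul hD]
  -- exponent identities
  set Θ : ℝ := 3 * (θ - 1) / (4 * (θ + 2)) with hΘ
  have h1 : (θ - 1) / θ * e = 2 * Θ := by rw [he, hΘ]; field_simp; ring
  have h2 : 3 / θ * e = 9 / (2 * (θ + 2)) := by rw [he]; field_simp; ring
  have h3 : 9 / (2 * (θ + 2)) + 1 / 2 = 2 * (1 - Θ) := by rw [hΘ]; field_simp; ring
  -- the square of the target
  set T : ℝ := θ * Real.sqrt ((θ - 2) * C * N) * c ^ (9 / (4 * (θ + 2))) * E ^ Θ * D ^ (1 - Θ)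
    with hT
  have hT0 : 0 ≤ T := by rw [hT]; positivity
  have hT2 : T ^ 2 = θ ^ 2 * ((θ - 2) * C * N) *
      (E ^ (2 * Θ) * (c ^ (9 / (2 * (θ + 2))) * D ^ (2 * (1 - Θ)))) := by
    rw [hT]
    have hs : Real.sqrt ((θ - 2) * C * N) ^ 2 = (θ - 2) * C * N := Real.sq_sqrt (by positivity)
    have hc2 : (c ^ (9 / (4 * (θ + 2)))) ^ 2 = c ^ (9 / (2 * (θ + 2))) := by
      rw [← Real.rpow_natCast (c ^ (9 / (4 * (θ + 2)))) 2, ← Real.rpow_mul hc]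
      congr 1; push_cast; field_simp; ring
    have hE2 : (E ^ Θ) ^ 2 = E ^ (2 * Θ) := by
      rw [← Real.rpow_natCast (E ^ Θ) 2, ← Real.rpow_mul hE]; congr 1; push_cast; ring
    have hD2 : (D ^ (1 - Θ)) ^ 2 = D ^ (2 * (1 - Θ)) := by
      rw [← Real.rpow_natCast (D ^ (1 - Θ)) 2, ← Real.rpow_mul hD]; congr 1; push_cast; ring
    calc (θ * Real.sqrt ((θ - 2) * C * N) * c ^ (9 / (4 * (θ + 2))) * E ^ Θ * D ^ (1 - Θ)) ^ 2
        = θ ^ 2 * Real.sqrt ((θ - 2) * C * N) ^ 2 * (c ^ (9 / (4 * (θ + 2)))) ^ 2 *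
            (E ^ Θ) ^ 2 * (D ^ (1 - Θ)) ^ 2 := by ring
      _ = _ := by rw [hs, hc2, hE2, hD2]; ring
  have hX2 : X ^ 2 ≤ T ^ 2 := by
    rw [hT2]
    refine hsq.trans ?_
    have hfac : 0 ≤ θ ^ 2 * ((θ - 2) * C * N) := by positivity
    calc θ ^ 2 * ((θ - 2) * C * N) * M ^ e * D ^ (1 / 2 : ℝ)
        ≤ θ ^ 2 * ((θ - 2) * C * N) *
            (E ^ ((θ - 1) / θ * e) * (c ^ (3 / θ * e) * D ^ (3 / θ * e))) * D ^ (1 / 2 : ℝ) :=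
          mul_le_mul_of_nonneg_right (mul_le_mul_of_nonneg_left hMe hfac) (Real.rpow_nonneg hD _)
      _ = θ ^ 2 * ((θ - 2) * C * N) *
            (E ^ (2 * Θ) * (c ^ (9 / (2 * (θ + 2))) * D ^ (2 * (1 - Θ)))) := by
          rw [h1, h2, ← h3, Real.rpow_add' hD (by positivity)]
          ring
  calc X = Real.sqrt (X ^ 2) := (Real.sqrt_sq hX).symm
    _ ≤ Real.sqrt (T ^ 2) := Real.sqrt_le_sqrt hX2
    _ = T := Real.sqrt_sq hT0

end Algebra

end Literature.Analysis.FluidPDE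

end
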